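import Literature.Analysis.FunctionSpaces.BMO
import Mathlib.MeasureTheory.Constructions.HaarToSphere
import Mathlib.MeasureTheory.Measure.Lebesgue.EqHaar
import Mathlib.Analysis.SpecialFunctions.Integrability.Basic
import HarnessLib

/-!
# BMO: `log ‖x‖` has bounded mean oscillation (discharge of `Literature.Analysis.FunctionSpaces.memBMO_log_norm`)

Topic `Analysis/FunctionSpaces`; proofs companion of
`Literature/Analysis/FunctionSpaces/BMO.lean` (next to `BMOProofs`, `BMOBoundedProofs`,
`BMOJohnNirenberg`). This file discharges the named fact

* `Literature.Analysis.FunctionSpaces.memBMO_log_norm` — on a finite-dimensional real inner product space `E` with its Lebesgue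
  (Haar) measure, the unbounded function `x ↦ log ‖x‖` belongs to `BMO(E)` (John–Nirenberg 1961,
  §1, the example following the definition; Stein, *Harmonic Analysis* IV.1.1.2; Grafakos,
  *Modern Fourier Analysis*, 3rd ed., Example 3.1.3, held scan pp. 202–203):
  `Literature.Analysis.FunctionSpaces.memBMO_log_norm_holds`.

## Proof

We follow Grafakos, *Modern Fourier Analysis*, 3rd ed., Example 3.1.3 (pp. 202–203 of the held
scan), with balls `B = B(x₀, r)` (the tree's `eBMOSeminorm` is the ball seminorm):

* (`Literature.Analysis.FunctionSpaces.BMOLog.laverage_enorm_sub_setAverage_le_two_mul`, Grafakos Prop. 3.1.2 (3), p. 202)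
  for every constant `c`, `⨍_B ‖f - f_B‖ ≤ 2 ⨍_B ‖f - c‖`, since
  `‖f - f_B‖ ≤ ‖f - c‖ + ‖c - f_B‖` and `‖c - f_B‖ = ‖⨍_B (c - f)‖ ≤ ⨍_B ‖f - c‖`;
* (`Literature.Analysis.FunctionSpaces.BMOLog.abs_log_norm_sub_log_norm_le`) if `‖x₀‖ ≥ 2r`, then `‖y‖ / ‖x₀‖ ∈ (1/2, 3/2)` on
  `B`, so `|log ‖y‖ - log ‖x₀‖| ≤ log 2` and `⨍_B |log ‖·‖ - log ‖x₀‖| ≤ log 2`;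
* (`Literature.Analysis.FunctionSpaces.BMOLog.exists_lintegral_ball_log_norm_sub_le`) if `‖x₀‖ < 2r`, then `B ⊆ B(0, 3r)` and,
  by the scaling `y = 3r · z` of the Haar measure (`MeasureTheory.Measure.map_addHaar_smul`),
  `∫_{B(0,3r)} |log ‖y‖ - log (3r)| dy = (3r)^d ∫_{B(0,1)} |log ‖z‖| dz`, whence
  `⨍_B |log ‖·‖ - log (3r)| ≤ 3^d ⨍_{B(0,1)} |log ‖z‖| dz`;
* the last average is finite, i.e. `log ‖·‖ ∈ L¹(B(0,1))` (and `log ‖·‖` is locally integrable,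
  `Literature.Analysis.FunctionSpaces.BMOLog.locallyIntegrable_log_norm`): by the polar-coordinates criterion
  `MeasureTheory.integrableOn_fun_norm_addHaar`, integrability of the radial function `log ‖x‖`
  on `B(0, R)` is integrability of `ρ ↦ ρ^{d-1} log ρ` on `(0, R)`, which follows from that of
  `log` (`intervalIntegral.intervalIntegrable_log'`).

Hence `‖log ‖·‖‖_* ≤ 2 (3^d ⨍_{B(0,1)} |log ‖z‖| dz + log 2) < ∞`. The zero space `E = {0}`
(excluded by `integrableOn_fun_norm_addHaar`) is treated apart: there `log ‖x‖ ≡ 0`.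

## References

* F. John, L. Nirenberg, *On functions of bounded mean oscillation*, Comm. Pure Appl. Math. 14
  (1961), 415–426, §1. [JohnNirenberg1961]
* L. Grafakos, *Modern Fourier Analysis*, 3rd ed., GTM 250 (2014), §3.1.1, Proposition 3.1.2 (3)
  and Example 3.1.3 (held scan pp. 201–203). [GrafakosMFA2014]
* E. M. Stein, *Harmonic Analysis: Real-Variable Methods, Orthogonality, and Oscillatory
  Integrals* (1993), Ch. IV §1.1.2. [SteinHA1993]
-/

noncomputable section

open MeasureTheory Metric Filter Topology Set
open scoped ENNReal NNReal

namespace Literature.Analysis.FunctionSpaces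

namespace BMOLog

/-! ## Mean oscillation versus deviation from a constant -/

section Oscillation

variable {α : Type*} [MeasurableSpace α] {μ : Measure α}
variable {F : Type*} [NormedAddCommGroup F] [NormedSpace ℝ F] [CompleteSpace F]

/-- **Mean oscillation is at most twice the mean deviation from any constant**: for `f`
integrable on a set `s` of finite positive measure and any `c`,
`⨍⁻_s ‖f - f_s‖ₑ ≤ 2 ⨍⁻_s ‖f - c‖ₑ`, because `‖f - f_s‖ ≤ ‖f - c‖ + ‖c - f_s‖` and
`‖c - f_s‖ = ‖⨍_s (c - f)‖ ≤ ⨍_s ‖f - c‖` (Grafakos, *Modern Fourier Analysis*, 3rd ed.,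
Proposition 3.1.2 (3) and its proof, held scan pp. 201–202). [cite: GrafakosMFA2014, Proposition 3.1.2 (3)] -/
theorem laverage_enorm_sub_setAverage_le_two_mul {f : α → F} {s : Set α}
    (hf : IntegrableOn f s μ) (hs₀ : μ s ≠ 0) (hs : μ s ≠ ∞) (c : F) :
    ⨍⁻ y in s, ‖f y - ⨍ z in s, f z ∂μ‖ₑ ∂μ ≤ 2 * ⨍⁻ y in s, ‖f y - c‖ₑ ∂μ := by
  rw [setAverage_eq', setLAverage_eq', setLAverage_eq']
  set ν : Measure α := (μ s)⁻¹ • μ.restrict s with hν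
  haveI : IsProbabilityMeasure ν := by
    refine ⟨?_⟩
    rw [hν, Measure.smul_apply, smul_eq_mul, Measure.restrict_apply_univ,
      ENNReal.inv_mul_cancel hs₀ hs]
  have hfν : Integrable f ν := hf.integrable.smul_measure (ENNReal.inv_ne_top.2 hs₀)
  have hdev : ‖c - ∫ z, f z ∂ν‖ₑ ≤ ∫⁻ y, ‖f y - c‖ₑ ∂ν := by
    have h1 : c - ∫ z, f z ∂ν = ∫ z, (c - f z) ∂ν := by
      rw [integral_sub (integrable_const c) hfν, integral_const, probReal_univ, one_smul]
    rw [h1]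
    refine (enorm_integral_le_lintegral_enorm _).trans_eq (lintegral_congr fun y => ?_)
    exact enorm_sub_rev _ _
  calc ∫⁻ y, ‖f y - ∫ z, f z ∂ν‖ₑ ∂ν
      ≤ ∫⁻ y, ‖f y - c‖ₑ + ‖c - ∫ z, f z ∂ν‖ₑ ∂ν := by
        refine lintegral_mono fun y => ?_
        calc ‖f y - ∫ z, f z ∂ν‖ₑ = ‖(f y - c) + (c - ∫ z, f z ∂ν)‖ₑ := by
              rw [sub_add_sub_cancel]
          _ ≤ ‖f y - c‖ₑ + ‖c - ∫ z, f z ∂ν‖ₑ := enorm_add_le _ _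
    _ = (∫⁻ y, ‖f y - c‖ₑ ∂ν) + ‖c - ∫ z, f z ∂ν‖ₑ := by
        rw [lintegral_add_right _ measurable_const, lintegral_const, measure_univ, mul_one]
    _ ≤ (∫⁻ y, ‖f y - c‖ₑ ∂ν) + ∫⁻ y, ‖f y - c‖ₑ ∂ν := add_le_add le_rfl hdev
    _ = 2 * ∫⁻ y, ‖f y - c‖ₑ ∂ν := (two_mul _).symm

end Oscillation

/-! ## The far balls: `log ‖·‖` oscillates by at most `log 2` -/

section Far

variable {E : Type*} [NormedAddCommGroup E]

/-- On a ball `B(x₀, r)` with `2r ≤ ‖x₀‖` one has `‖x₀‖/2 < ‖y‖ < 3‖x₀‖/2`, hence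
`|log ‖y‖ - log ‖x₀‖| ≤ log 2` (Grafakos, *Modern Fourier Analysis*, 3rd ed., Example 3.1.3,
the case `|x₀| > 2R`, held scan p. 202). [cite: GrafakosMFA2014, Example 3.1.3] -/
theorem abs_log_norm_sub_log_norm_le {x₀ y : E} {r : ℝ} (hr : 0 < r) (hx₀ : 2 * r ≤ ‖x₀‖)
    (hy : y ∈ ball x₀ r) : |Real.log ‖y‖ - Real.log ‖x₀‖| ≤ Real.log 2 := by
  have hx₀pos : 0 < ‖x₀‖ := by linarith
  have hdist : ‖y - x₀‖ < r := mem_ball_iff_norm.1 hy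
  have h1 : ‖x₀‖ - ‖y‖ ≤ ‖y - x₀‖ := by rw [norm_sub_rev]; exact norm_sub_norm_le x₀ y
  have h2 : ‖y‖ - ‖x₀‖ ≤ ‖y - x₀‖ := norm_sub_norm_le y x₀
  have hypos : 0 < ‖y‖ := by linarith
  rw [abs_sub_le_iff]
  constructor
  · have h : Real.log ‖y‖ ≤ Real.log (2 * ‖x₀‖) := Real.log_le_log hypos (by linarith)
    rw [Real.log_mul two_ne_zero hx₀pos.ne'] at h
    linarith
  · have h : Real.log ‖x₀‖ ≤ Real.log (2 * ‖y‖) := Real.log_le_log hx₀pos (by linarith)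
    rw [Real.log_mul two_ne_zero hypos.ne'] at h
    linarith

end Far

/-! ## The balls near the origin: scaling and local integrability -/

section LogNorm

variable {E : Type*} [NormedAddCommGroup E] [InnerProductSpace ℝ E] [FiniteDimensional ℝ E]
  [MeasurableSpace E] [BorelSpace E]

/-- **Scaling of the Lebesgue measure under dilations**, lower-integral form:
`∫ g(t x) dx = |t|^{-d} ∫ g` for `t ≠ 0` (from `MeasureTheory.Measure.map_addHaar_smul`). [folklore] -/
theorem lintegral_comp_smul (g : E → ℝ≥0∞) {t : ℝ} (ht : t ≠ 0) :
    ∫⁻ x, g (t • x) = ENNReal.ofReal |(t ^ Module.finrank ℝ E)⁻¹| * ∫⁻ y, g y := by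
  calc ∫⁻ x, g (t • x) = ∫⁻ y, g y ∂(Measure.map (fun x : E => t • x) volume) :=
        (lintegral_map_equiv g
          (Homeomorph.smul (isUnit_iff_ne_zero.2 ht).unit).toMeasurableEquiv).symm
    _ = ENNReal.ofReal |(t ^ Module.finrank ℝ E)⁻¹| * ∫⁻ y, g y := by
        rw [Measure.map_addHaar_smul volume ht, lintegral_smul_measure, smul_eq_mul]

/-- `log ‖x‖` is integrable on every ball `B(0, R)` of a finite-dimensional real inner product
space of positive dimension: by polar coordinates (`MeasureTheory.integrableOn_fun_norm_addHaar`)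
this is the integrability of `ρ ↦ ρ^{d-1} log ρ` on `(0, R)`, i.e. that of `log` near `0`
(Grafakos, *Modern Fourier Analysis*, 3rd ed., Example 3.1.3: finiteness of
`∫_{|z| ≤ 3} |log |z|| dz`, held scan p. 203). [cite: GrafakosMFA2014, Example 3.1.3] -/
theorem integrableOn_log_norm_ball [Nontrivial E] (R : ℝ) :
    IntegrableOn (fun x : E => Real.log ‖x‖) (ball (0 : E) R) := by
  rw [integrableOn_fun_norm_addHaar volume (f := Real.log)]
  have hlog : IntegrableOn Real.log (Ioo 0 R) :=
    (intervalIntegral.intervalIntegrable_log' (a := 0) (b := R)).1.mono_set Ioo_subset_Ioc_self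
  exact hlog.continuousOn_smul_of_subset (continuous_pow _).continuousOn isCompact_Icc
    measurableSet_Ioo Ioo_subset_Icc_self

/-- `log ‖x‖` is locally integrable on a finite-dimensional real inner product space (the
standing requirement `f ∈ L¹_loc` of the definition of `BMO`; Grafakos, *Modern Fourier
Analysis*, 3rd ed., Definition 3.1.1 and Example 3.1.3). For `E = {0}` the function is `0`. [cite: GrafakosMFA2014, Example 3.1.3] -/
theorem locallyIntegrable_log_norm : LocallyIntegrable (fun x : E => Real.log ‖x‖) := by
  rcases subsingleton_or_nontrivial E with hE | hE
  · have h0 : (fun x : E => Real.log ‖x‖) = fun _ => 0 := by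
      funext x
      simp [Subsingleton.elim x 0]
    rw [h0]
    exact locallyIntegrable_zero
  · refine locallyIntegrable_iff.2 fun k hk => ?_
    obtain ⟨R, hR⟩ := hk.isBounded.subset_ball 0
    exact (integrableOn_log_norm_ball R).mono_set hR

/-- **The scaling estimate** (Grafakos, *Modern Fourier Analysis*, 3rd ed., Example 3.1.3, the
case `|x₀| ≤ 2R`, held scan p. 203): there is `K < ∞` (namely
`⨍_{B(0,1)} |log ‖z‖| dz`) with `∫_{B(0,R)} |log ‖y‖ - log R| dy ≤ K |B(0,R)|` for every
`R > 0`; indeed the substitution `y = R z` turns the left-hand side into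
`R^d ∫_{B(0,1)} |log ‖z‖| dz`. [cite: GrafakosMFA2014, Example 3.1.3] -/
theorem exists_lintegral_ball_log_norm_sub_le [Nontrivial E] :
    ∃ K : ℝ≥0∞, K < ∞ ∧ ∀ R : ℝ, 0 < R →
      ∫⁻ y in ball (0 : E) R, ‖Real.log ‖y‖ - Real.log R‖ₑ ≤ K * volume (ball (0 : E) R) := by
  have hI₁ : ∫⁻ z in ball (0 : E) 1, ‖Real.log ‖z‖‖ₑ < ∞ :=
    (integrableOn_log_norm_ball (E := E) 1).hasFiniteIntegral
  have hB₀ : volume (ball (0 : E) 1) ≠ 0 := (measure_ball_pos volume (0 : E) one_pos).ne'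
  have hBtop : volume (ball (0 : E) 1) ≠ ∞ := measure_ball_lt_top.ne
  refine ⟨(∫⁻ z in ball (0 : E) 1, ‖Real.log ‖z‖‖ₑ) * (volume (ball (0 : E) 1))⁻¹,
    ENNReal.mul_lt_top hI₁ (ENNReal.inv_lt_top.2 (pos_iff_ne_zero.2 hB₀)), fun R hR => ?_⟩
  have hnull : volume ({0} : Set E) = 0 := measure_singleton 0
  -- the unit-ball integrand, extended by zero
  have hmem : ∀ y ∈ ball (0 : E) R \ {0}, R⁻¹ • y ∈ ball (0 : E) 1 := by
    intro y hy
    have hyR : ‖y‖ < R := mem_ball_zero_iff.1 hy.1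
    rw [mem_ball_zero_iff, norm_smul, norm_inv, Real.norm_of_nonneg hR.le]
    exact (mul_lt_mul_of_pos_left hyR (inv_pos.2 hR)).trans_eq (inv_mul_cancel₀ hR.ne')
  calc ∫⁻ y in ball (0 : E) R, ‖Real.log ‖y‖ - Real.log R‖ₑ
      = ∫⁻ y in ball (0 : E) R \ {0}, ‖Real.log ‖y‖ - Real.log R‖ₑ :=
        (setLIntegral_congr (sdiff_null_ae_eq_self hnull)).symm
    _ = ∫⁻ y in ball (0 : E) R \ {0},
          (ball (0 : E) 1).indicator (fun z => ‖Real.log ‖z‖‖ₑ) (R⁻¹ • y) := by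
        refine setLIntegral_congr_fun (measurableSet_ball.diff (measurableSet_singleton 0)) ?_
        intro y hy
        have hy0 : y ≠ 0 := hy.2
        dsimp only
        rw [indicator_of_mem (hmem y hy), norm_smul, norm_inv, Real.norm_of_nonneg hR.le,
          Real.log_mul (inv_ne_zero hR.ne') (norm_ne_zero_iff.2 hy0), Real.log_inv]
        congr 1
        ring
    _ ≤ ∫⁻ y, (ball (0 : E) 1).indicator (fun z => ‖Real.log ‖z‖‖ₑ) (R⁻¹ • y) :=
        setLIntegral_le_lintegral _ _
    _ = ENNReal.ofReal |((R⁻¹) ^ Module.finrank ℝ E)⁻¹| *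
          ∫⁻ z, (ball (0 : E) 1).indicator (fun z => ‖Real.log ‖z‖‖ₑ) z :=
        lintegral_comp_smul _ (inv_ne_zero hR.ne')
    _ = ENNReal.ofReal (R ^ Module.finrank ℝ E) * ∫⁻ z in ball (0 : E) 1, ‖Real.log ‖z‖‖ₑ := by
        rw [lintegral_indicator measurableSet_ball, inv_pow, inv_inv, abs_of_pos (pow_pos hR _)]
    _ = (∫⁻ z in ball (0 : E) 1, ‖Real.log ‖z‖‖ₑ) * (volume (ball (0 : E) 1))⁻¹ *
          volume (ball (0 : E) R) := by
        rw [Measure.addHaar_ball_of_pos volume (0 : E) hR]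
        calc ENNReal.ofReal (R ^ Module.finrank ℝ E) * ∫⁻ z in ball (0 : E) 1, ‖Real.log ‖z‖‖ₑ
            = ENNReal.ofReal (R ^ Module.finrank ℝ E) * (∫⁻ z in ball (0 : E) 1, ‖Real.log ‖z‖‖ₑ) *
                ((volume (ball (0 : E) 1))⁻¹ * volume (ball (0 : E) 1)) := by
              rw [ENNReal.inv_mul_cancel hB₀ hBtop, mul_one]
          _ = _ := by ring

/-- `log ‖x‖ ∈ BMO(E)` for `E` of positive dimension (Grafakos, *Modern Fourier Analysis*,
3rd ed., Example 3.1.3, held scan pp. 202–203): for a ball `B(x₀, r)` take the constant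
`c = log ‖x₀‖` if `2r ≤ ‖x₀‖` (oscillation `≤ log 2`) and `c = log (3r)` otherwise
(`B ⊆ B(0, 3r)` and the scaling estimate), then `⨍_B |f - f_B| ≤ 2 ⨍_B |f - c|`. [cite: GrafakosMFA2014, Example 3.1.3] -/
theorem memBMO_log_norm_of_nontrivial [Nontrivial E] :
    MemBMO (fun x : E => Real.log ‖x‖) := by
  refine ⟨locallyIntegrable_log_norm, ?_⟩
  obtain ⟨K, hK, hbound⟩ := exists_lintegral_ball_log_norm_sub_le (E := E)
  obtain ⟨C, hCtop, hC2, hC3⟩ : ∃ C : ℝ≥0∞, C < ∞ ∧ ENNReal.ofReal (Real.log 2) ≤ C ∧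
      ENNReal.ofReal (3 ^ Module.finrank ℝ E) * K ≤ C :=
    ⟨ENNReal.ofReal (3 ^ Module.finrank ℝ E) * K + ENNReal.ofReal (Real.log 2),
      ENNReal.add_lt_top.2 ⟨ENNReal.mul_lt_top ENNReal.ofReal_lt_top hK, ENNReal.ofReal_lt_top⟩,
      le_add_self, le_self_add⟩
  have h2C : 2 * C < ∞ := ENNReal.mul_lt_top (by simp) hCtop
  refine lt_of_le_of_lt ?_ h2C
  refine iSup_le fun x₀ => iSup₂_le fun r hr => ?_
  have hB₀ : volume (ball x₀ r) ≠ 0 := (measure_ball_pos volume x₀ hr).ne'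
  have hBtop : volume (ball x₀ r) ≠ ∞ := measure_ball_lt_top.ne
  have hint : IntegrableOn (fun x : E => Real.log ‖x‖) (ball x₀ r) :=
    (locallyIntegrable_log_norm.integrableOn_isCompact (isCompact_closedBall x₀ r)).mono_set
      ball_subset_closedBall
  -- a constant `c` with `∫⁻_B ‖f - c‖ₑ ≤ C · |B|`
  obtain ⟨c, hc⟩ : ∃ c : ℝ,
      ∫⁻ y in ball x₀ r, ‖Real.log ‖y‖ - c‖ₑ ≤ C * volume (ball x₀ r) := by
    rcases le_or_gt (2 * r) ‖x₀‖ with hfar | hnear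
    · refine ⟨Real.log ‖x₀‖, ?_⟩
      calc ∫⁻ y in ball x₀ r, ‖Real.log ‖y‖ - Real.log ‖x₀‖‖ₑ
          ≤ ∫⁻ _ in ball x₀ r, ENNReal.ofReal (Real.log 2) := by
            refine setLIntegral_mono' measurableSet_ball fun y hy => ?_
            rw [Real.enorm_eq_ofReal_abs]
            exact ENNReal.ofReal_le_ofReal (abs_log_norm_sub_log_norm_le hr hfar hy)
        _ = ENNReal.ofReal (Real.log 2) * volume (ball x₀ r) := setLIntegral_const _ _
        _ ≤ C * volume (ball x₀ r) := by gcongr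
    · refine ⟨Real.log (3 * r), ?_⟩
      have hsub : ball x₀ r ⊆ ball (0 : E) (3 * r) := by
        intro y hy
        rw [mem_ball_zero_iff]
        have h1 : ‖y‖ - ‖x₀‖ ≤ ‖y - x₀‖ := norm_sub_norm_le y x₀
        have h2 : ‖y - x₀‖ < r := mem_ball_iff_norm.1 hy
        linarith
      have h3r : 0 < 3 * r := by positivity
      calc ∫⁻ y in ball x₀ r, ‖Real.log ‖y‖ - Real.log (3 * r)‖ₑ
          ≤ ∫⁻ y in ball (0 : E) (3 * r), ‖Real.log ‖y‖ - Real.log (3 * r)‖ₑ :=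
            lintegral_mono_set hsub
        _ ≤ K * volume (ball (0 : E) (3 * r)) := hbound _ h3r
        _ = K * (ENNReal.ofReal (3 ^ Module.finrank ℝ E) * volume (ball x₀ r)) := by
            rw [Measure.addHaar_ball_mul_of_pos volume (0 : E) (by norm_num : (0 : ℝ) < 3) r,
              Measure.addHaar_ball_center volume x₀ r]
        _ = ENNReal.ofReal (3 ^ Module.finrank ℝ E) * K * volume (ball x₀ r) := by ring
        _ ≤ C * volume (ball x₀ r) := by gcongr
  -- (`∂volume` is spelled out: the `volume` form of the `⨍⁻ _ in _, _` notation is unusable)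
  calc ⨍⁻ y in ball x₀ r, ‖Real.log ‖y‖ - ⨍ z in ball x₀ r, Real.log ‖z‖‖ₑ ∂volume
      ≤ 2 * ⨍⁻ y in ball x₀ r, ‖Real.log ‖y‖ - c‖ₑ ∂volume :=
        laverage_enorm_sub_setAverage_le_two_mul hint hB₀ hBtop c
    _ ≤ 2 * C := by
        gcongr
        rw [setLAverage_eq]
        exact ENNReal.div_le_of_le_mul hc

omit [InnerProductSpace ℝ E] [FiniteDimensional ℝ E] [MeasurableSpace E] [BorelSpace E] in
/-- On the zero space `log ‖x‖ ≡ 0`. [folklore] -/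
theorem log_norm_eq_zero_of_subsingleton [Subsingleton E] :
    (fun x : E => Real.log ‖x‖) = fun _ => 0 := by
  funext x
  simp [Subsingleton.elim x 0]

/-- `log ‖x‖ ∈ BMO(E)` for the zero space `E = {0}`, where the function vanishes identically
(the degenerate case of Grafakos, *Modern Fourier Analysis*, 3rd ed., Example 3.1.3). [cite: GrafakosMFA2014, Example 3.1.3] -/
theorem memBMO_log_norm_of_subsingleton [Subsingleton E] :
    MemBMO (fun x : E => Real.log ‖x‖) := by
  rw [log_norm_eq_zero_of_subsingleton]
  refine ⟨locallyIntegrable_zero, ?_⟩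
  have h : eBMOSeminorm (fun _ : E => (0 : ℝ)) volume = 0 := by
    simp only [eBMOSeminorm, ENNReal.iSup_eq_zero]
    intro x r _
    simp
  rw [h]
  exact ENNReal.zero_lt_top

end LogNorm

end BMOLog

/-- **`log ‖x‖ ∈ BMO`** (discharge of the named fact `Literature.Analysis.FunctionSpaces.memBMO_log_norm`): on every
finite-dimensional real inner product space `E` with Lebesgue measure, the unbounded function
`x ↦ log ‖x‖` is locally integrable and has finite (ball) BMO seminorm (John–Nirenberg 1961, §1,
the example following the definition of bounded mean oscillation; Stein, *Harmonic Analysis*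
IV.1.1.2; proof after Grafakos, *Modern Fourier Analysis*, 3rd ed., Example 3.1.3, held scan
pp. 202–203, via `Literature.Analysis.FunctionSpaces.BMOLog.memBMO_log_norm_of_nontrivial`; the zero space is
`Literature.Analysis.FunctionSpaces.BMOLog.memBMO_log_norm_of_subsingleton`). [cite: JohnNirenberg1961, §1 example] -/
theorem memBMO_log_norm_holds : memBMO_log_norm := by
  intro E _ _ _ _ _
  rcases subsingleton_or_nontrivial E with hE | hE
  · exact BMOLog.memBMO_log_norm_of_subsingleton
  · exact BMOLog.memBMO_log_norm_of_nontrivial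

end Literature.Analysis.FunctionSpaces
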